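import Summits.ValiantsHypothesis.ValiantsHypothesis.Theorems.DefinabilityGapAffineRung
import Summits.ValiantsHypothesis.ValiantsHypothesis.Theorems.DefinabilityGapK2cVPSPACE0Rung
import Summits.ValiantsHypothesis.ValiantsHypothesis.Theorems.DefinabilityGapK2cPFamilyRung
import Summits.ValiantsHypothesis.ValiantsHypothesis.Theorems.DefinabilityGapK2cIntegralRung
import Mathlib.RingTheory.AlgebraicIndependent.TranscendenceBasis
import HarnessLib

/-!
# DefinabilityGap — ceilings for the certificate roads toward `KIPlantedHitting` (item 23547)

Route `DefinabilityGap` (K1 = `KIPlantedHitting`: the KI-planted permanent map `G_m = kiPer m` hits every nonzero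
`D` of size and degree `≤ q(m)^b`, infinitely often in `m`, for every `b`). Two roads toward its clauses are
closed here by theorems about `G_m` alone (decomp-valiant lens 5, gen 8):

* **Support road ends at `b = 3`.** The sub-reading relaxation of clause `b` ("every nonzero `D` of degree
  `≤ q^b` involving `≤ 2q^b+1` coordinates is hit") is FALSE for every `b ≥ 3`: nonzero annihilators of `G_m` of
  total degree `≤ q³` exist for all large `m` (`exists_lowDegree_annihilator`, a repackaging of the landed
  multilinear `VPSPACE⁰_b` annihilators `k2c_vpspace0b_rung`), and `≤ 2q^b+1` is no restriction on `q³`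
  coordinates (`not_supportHitting_of_three_le`).
* **Independence (girth) certificates are capped at `m²·q < q²` curves.** The block permanents live in the
  polynomial ring on the `m²q` used seed cells, so at most `m²q` of them are algebraically independent
  (`card_le_of_algebraicIndependent`; coarse form `not_algebraicIndependent_of_sq_lt_card`); hence no eventual
  girth bound `> m²q` — in particular not the `2q²+1` that clause `b = 2` would consume — is attainable
  (`not_eventualGirth_of_usedCells_lt`, `not_eventualGirth_two_sq`).

VP ≠ VNP is not proved here; these are negative-knowledge / placement theorems for item 23547.
-/

noncomputable section

open MvPolynomial
open Literature.Computability.AlgebraicComplexity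
open Summit.ValiantsHypothesis.ValiantsHypothesis.Theorems.DefinabilityGapAffineRung
open Summit.ValiantsHypothesis.ValiantsHypothesis.Theorems.DefinabilityGapK2cPFamilyRung
  (totalDegree_le_card_mul_of_degreeOf_le)
open Summit.ValiantsHypothesis.ValiantsHypothesis.Theorems.DefinabilityGapK2cVPSPACE0Rung (k2c_vpspace0b_rung)

namespace Summit.ValiantsHypothesis.ValiantsHypothesis.Theorems.DefinabilityGapCertificateCeilings

/-! ## 1. Low-degree annihilators exist; the support road ends at `b = 3` -/

/-- `1 ≤ q(m)`. [folklore] -/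
theorem one_le_qOf (m : ℕ) : 1 ≤ qOf m := (qOf_spec m).2.one_lt.le

/-- **Low-degree annihilators exist for all large `m`**: a nonzero `D` with `D ∘ G_m = 0` and `deg D ≤ q³`
(the landed integer multilinear `VPSPACE⁰_b` annihilator, mapped to `ℂ`). [this file] -/
theorem exists_lowDegree_annihilator : ∃ m₁, ∀ m, m₁ ≤ m →
    ∃ D : MvPolynomial (Fin 3 → Fin (qOf m)) ℂ, D ≠ 0 ∧ bind₁ (kiPer m) D = 0 ∧
      D.totalDegree ≤ qOf m ^ 3 := by
  classical
  obtain ⟨A, -, hAml, m₁, hA⟩ := k2c_vpspace0b_rung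
  refine ⟨m₁, fun m hm => ?_⟩
  obtain ⟨hA0, hann⟩ := hA m hm
  refine ⟨map (Int.castRingHom ℂ) (A m), ?_, hann, ?_⟩
  · intro hD
    apply hA0
    apply map_injective (Int.castRingHom ℂ) (RingHom.injective_int _)
    rw [hD, map_zero]
  · have hsupp : (map (Int.castRingHom ℂ) (A m)).support ⊆ (A m).support := support_map_subset _ _
    refine (Theorems.DefinabilityGapK2cIntegralRung.totalDegree_le_of_support_subset hsupp).trans ?_
    refine (totalDegree_le_card_mul_of_degreeOf_le (hAml m)).trans ?_
    simp [Fintype.card_fin]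

/-- **The support road ends at `b = 3`**: for `b ≥ 3` the statement "for infinitely many `m`, every nonzero `D`
with `≤ 2q^b+1` variables and degree `≤ q^b` is hit by `G_m`" is FALSE (the variable bound is vacuous on `q³`
coordinates and degree-`≤ q³` annihilators exist). [this file] -/
theorem not_supportHitting_of_three_le {b : ℕ} (hb : 3 ≤ b) :
    ¬ (∀ m₀ : ℕ, ∃ m, m₀ ≤ m ∧ ∀ D : MvPolynomial (Fin 3 → Fin (qOf m)) ℂ, D ≠ 0 →
        D.vars.card ≤ 2 * qOf m ^ b + 1 → D.totalDegree ≤ qOf m ^ b → bind₁ (kiPer m) D ≠ 0) := by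
  classical
  intro h
  obtain ⟨m₁, hm₁⟩ := exists_lowDegree_annihilator
  obtain ⟨m, hm, hhit⟩ := h m₁
  obtain ⟨D, hD0, hann, hdeg⟩ := hm₁ m hm
  have hpow : qOf m ^ 3 ≤ qOf m ^ b := Nat.pow_le_pow_right (one_le_qOf m) hb
  refine hhit D hD0 ?_ (hdeg.trans hpow) hann
  calc D.vars.card ≤ (Finset.univ : Finset (Fin 3 → Fin (qOf m))).card := Finset.card_le_univ _
    _ = qOf m ^ 3 := by simp [Fintype.card_fin]
    _ ≤ 2 * qOf m ^ b + 1 := by omega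

/-! ## 2. The transcendence cap on independence certificates -/

open Cardinal in
/-- **Coarse transcendence cap**: more than `q²` block permanents are never algebraically independent
(`trdeg_ℂ ℂ[y] = q²`). [this file] -/
theorem not_algebraicIndependent_of_sq_lt_card (m : ℕ) (T : Finset (Fin 3 → Fin (qOf m)))
    (hT : qOf m ^ 2 < T.card) :
    ¬ AlgebraicIndependent ℂ (fun c : T => kiPer m (c : Fin 3 → Fin (qOf m))) := by
  intro h
  have h1 := h.cardinalMk_le_trdeg
  rw [MvPolynomial.trdeg_of_isDomain, Cardinal.mk_fintype, Cardinal.mk_fintype, Cardinal.lift_natCast,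
    Nat.cast_le, Fintype.card_coe, Fintype.card_prod, Fintype.card_fin] at h1
  rw [sq] at hT
  exact absurd (hT.trans_le h1) (lt_irrefl _)

/-- The seed cells the planted map actually uses: rows `< m²` of the `q × q` grid. [this file] -/
def usedCell (m : ℕ) : Fin (m * m) × Fin (qOf m) → Fin (qOf m) × Fin (qOf m) :=
  fun a => (Fin.castLE (sq_le_qOf m) a.1, a.2)

/-- Every variable of a block permanent is a used cell. [this file] -/
theorem vars_kiPer_subset_range (m : ℕ) (c : Fin 3 → Fin (qOf m)) :
    (↑(kiPer m c).vars : Set (Fin (qOf m) × Fin (qOf m))) ⊆ Set.range (usedCell m) := by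
  classical
  intro p hp
  rw [Finset.mem_coe, kiPer_eq_rename_cellEmb] at hp
  obtain ⟨ij, -, rfl⟩ := Finset.mem_image.1 (vars_rename _ _ hp)
  refine ⟨(finProdFinEquiv ij, (cellEmb m c ij).2), Prod.ext ?_ rfl⟩
  simp [usedCell, cellEmb, permPad]

open Cardinal in
/-- **Sharp transcendence cap**: at most `m²·q` block permanents are algebraically independent (they lie in the
subalgebra on the `m²q` used cells; e.g. `m = 3`: at most `99` of the `1331` curves, `m = 4`: at most `272` of
`4913`). [this file] -/
theorem card_le_of_algebraicIndependent (m : ℕ) (T : Finset (Fin 3 → Fin (qOf m)))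
    (h : AlgebraicIndependent ℂ (fun c : T => kiPer m (c : Fin 3 → Fin (qOf m)))) :
    T.card ≤ m * m * qOf m := by
  classical
  set S : Set (Fin (qOf m) × Fin (qOf m)) := Set.range (usedCell m) with hS
  have hmem : ∀ c : T, kiPer m (c : Fin 3 → Fin (qOf m)) ∈ MvPolynomial.supported ℂ S := fun c => by
    rw [mem_supported]; exact vars_kiPer_subset_range m c
  let x' : T → MvPolynomial.supported ℂ S := fun c => ⟨kiPer m (c : Fin 3 → Fin (qOf m)), hmem c⟩
  have hx' : AlgebraicIndependent ℂ x' :=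
    AlgebraicIndependent.of_comp (MvPolynomial.supported ℂ S).val h
  have h1 := hx'.cardinalMk_le_trdeg
  have h2 : Algebra.trdeg ℂ (MvPolynomial.supported ℂ S) ≤ Algebra.trdeg ℂ (MvPolynomial S ℂ) :=
    trdeg_le_of_injective (supportedEquivMvPolynomial S).toAlgHom (supportedEquivMvPolynomial S).injective
  have h3 : #S ≤ #(Fin (m * m) × Fin (qOf m)) := Cardinal.mk_range_le
  have h4 := h1.trans h2
  rw [MvPolynomial.trdeg_of_isDomain, Cardinal.lift_id] at h4
  have h5 := h4.trans h3
  rw [Cardinal.mk_fintype, Cardinal.mk_fintype, Nat.cast_le, Fintype.card_coe, Fintype.card_prod,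
    Fintype.card_fin, Fintype.card_fin] at h5
  exact h5

/-- **No eventual girth bound above the used cells**: if `g(m) > m²·q(m)` for all `m`, then from no `m₀` on are
all `≤ g(m)`-subfamilies of block permanents algebraically independent. [this file] -/
theorem not_eventualGirth_of_usedCells_lt (m₀ : ℕ) (g : ℕ → ℕ) (hg : ∀ m, m * m * qOf m < g m) :
    ¬ (∀ m, m₀ ≤ m → ∀ T : Finset (Fin 3 → Fin (qOf m)), T.card ≤ g m →
        AlgebraicIndependent ℂ (fun c : T => kiPer m (c : Fin 3 → Fin (qOf m)))) := by
  classical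
  intro h
  have hq : 2 ≤ qOf m₀ := (qOf_spec m₀).2.two_le
  have hmm : m₀ * m₀ ≤ qOf m₀ := sq_le_qOf m₀
  have hcard : m₀ * m₀ * qOf m₀ + 1 ≤ (Finset.univ : Finset (Fin 3 → Fin (qOf m₀))).card := by
    rw [Finset.card_univ, Fintype.card_fun, Fintype.card_fin, Fintype.card_fin]
    calc m₀ * m₀ * qOf m₀ + 1 ≤ qOf m₀ * qOf m₀ + qOf m₀ * qOf m₀ := by nlinarith
      _ = qOf m₀ * qOf m₀ * 2 := by ring
      _ ≤ qOf m₀ * qOf m₀ * qOf m₀ := Nat.mul_le_mul_left _ hq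
      _ = qOf m₀ ^ 3 := by ring
  obtain ⟨T, -, hT⟩ := Finset.exists_subset_card_eq hcard
  have hind := h m₀ le_rfl T (by rw [hT]; exact hg m₀)
  have := card_le_of_algebraicIndependent m₀ T hind
  omega

/-- In particular the girth road cannot reach clause `b = 2`: eventual girth `> 2q²+1` is impossible
(`m²q ≤ q·q < 2q²+1`). [this file] -/
theorem not_eventualGirth_two_sq (m₀ : ℕ) :
    ¬ (∀ m, m₀ ≤ m → ∀ T : Finset (Fin 3 → Fin (qOf m)), T.card ≤ 2 * qOf m ^ 2 + 1 →
        AlgebraicIndependent ℂ (fun c : T => kiPer m (c : Fin 3 → Fin (qOf m)))) :=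
  not_eventualGirth_of_usedCells_lt m₀ _ fun m => by
    have := sq_le_qOf m
    have : m * m * qOf m ≤ qOf m * qOf m := Nat.mul_le_mul_right _ this
    nlinarith

end Summit.ValiantsHypothesis.ValiantsHypothesis.Theorems.DefinabilityGapCertificateCeilings

end
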